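import Summits.CriticalPhenomena.PercolationContinuityZ3.Theorems.PercNearOneGluingNoHeavyLowerTailSunflowerNuSpanBound
import Summits.CriticalPhenomena.PercolationContinuityZ3.Theorems.PercNearOneGluingNoHeavyLowerTailSunflowerDownReaderExact
import HarnessLib
import HarnessLib.Audit

/-!
# `NoHeavyLowerTail` (crux stmt-CriticalPhenomena-4575), abstract sunflower cubic: ★ FROM THE RIVAL-FREE COUNT — a purely combinatorial sufficient
# condition (no linear algebra in the hypothesis)

Support file (seat `prim-l12-p2` gen 24; `--supports stmt-CriticalPhenomena-4575`).  No `sorry`, no new definitions.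
Memo: run/shared/lean/prim/prim-l12/prim-l12-p2/FINDING-g24-LOCAL-ASSIGNMENT.md (§5).
In a bottom cube `Lᶜ`, `P ∈ P14(Lᶜ)` (`lab P = 1`, `lab (Lᶜ∖P) = 4`) is RIVAL-FREE if no label-1 `T ⊆ Lᶜ∖P` has `lab (Lᶜ∖T) = 4`; in a kernel cube `Kᶜ`,
`Q ∈ P30(Kᶜ)` (`lab Q = 3`, `lab (Kᶜ∖Q) = 0`) is CO-RIVAL-FREE if no label-3 `T ⊆ Kᶜ` with `Kᶜ∖Q ⊆ T` has `lab (Kᶜ∖T) = 0`.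
* `Sunflower.nu_pair_row_block`, `Sunflower.mu_pair_col_block` — block pairings of the `M`-row / `N`-column functionals with the bare vectors `ν_P`, `μ_Q`.
* `Sunflower.nu_rivalFree_linearIndependent` — the `ν_P` of the rival-free `P ∈ P14(Lᶜ)` are linearly independent over `GF(2)` (up-reader `nu_read_up` of
  the `|P|`-maximal member of a dependency); `Sunflower.mu_corivalFree_linearIndependent` — dually for the co-rival-free `Q ∈ P30(Kᶜ)` (exact down-reader
  `mu_read_down_exact`, whose junk vanishes without co-rivals).  [The SHARP LEMMA of gen 23 and its cube dual, now as stand-alone statements.]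
* **`Sunflower.ZH_nonneg_of_rivalFreeCount`** — if
      `#rainbows ≤ #{(L,P) : lab L = 0, P ∈ P14(Lᶜ) rival-free} + #{(K,Q) : lab K = 4, Q ∈ P30(Kᶜ) co-rival-free}`      (RF-COUNT)
  then `0 ≤ ZH` (each count is the dimension of an independent family in the kernel of its cube, hence `≤ cubeSlack`, `finrank_span_le_cubeSlack`).
  RF-COUNT ⟹ `NuMuSpanInequality` for that sunflower.  CENSUS (gen 24, `code/rfcount.c`, kit j148326): RF-COUNT holds for EVERY sunflower on ≤ 5 points
  (n = 5 exhaustive: all 2 890 800 sunflowers with rainbows, 314 380 tight) and for ~3·10⁴ 'hard' sunflowers on 6–8 points, the doubled star (tight) and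
  `CS(3,3,3)`; it FAILS rarely from 6 points on (1 of 58 580 random sunflowers on 6 points, 3 of 6 766 sampled compositions on ≤ 7 points — there the
  ν-rank exceeds the rival-free count and NSI still holds), so this is a class theorem (containing all of n ≤ 5), not a route.
-/

namespace Summit.CriticalPhenomena.PercolationContinuityZ3.Theorems.SunflowerPartition

open Finset

variable {α : Type*} [Fintype α] [DecidableEq α]

namespace Sunflower

variable (F : Sunflower α)

/-- Pairing of the `M`-row functional of `Y ⊆ Lᶜ` (bottom block `L`) with the bare `(1|4)`-vector `ν_P`: the block sum equals the cube sum
`Σ_{O ⊆ Lᶜ} M(Y,O)·ν_P(Lᶜ∖O)` (non-kernel–bottom pairs contribute nothing). [this work] -/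
theorem nu_pair_row_block {L : Finset α} (hL0 : F.lab L = 0) (P Y : Finset α) :
    (∑ σ : ↥(F.sup.filter (fun σ => σ.2 = L)),
        (∑ R' ∈ (Lᶜ).powerset, (if F.lab R' = 0 ∧ (σ.1.1 ∪ σ.1.2)ᶜ ⊆ R' ∧ R' ⊆ Y then (1 : ZMod 2) else 0)) *
        (∑ R ∈ (Lᶜ).powerset, (if F.lab R = 4 ∧ P ⊆ R ∧ R ⊆ σ.1.1 then (1 : ZMod 2) else 0)))
      = ∑ O ∈ (Lᶜ).powerset,
          (∑ R' ∈ (Lᶜ).powerset, (if F.lab R' = 0 ∧ O ⊆ R' ∧ R' ⊆ Y then (1 : ZMod 2) else 0)) *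
          (∑ R ∈ (Lᶜ).powerset, (if F.lab R = 4 ∧ P ⊆ R ∧ R ⊆ Lᶜ \ O then (1 : ZMod 2) else 0)) := by
  rw [Finset.sum_coe_sort (F.sup.filter (fun σ => σ.2 = L))
    (fun σ => (∑ R' ∈ (Lᶜ).powerset, (if F.lab R' = 0 ∧ (σ.1 ∪ σ.2)ᶜ ⊆ R' ∧ R' ⊆ Y then (1 : ZMod 2) else 0)) *
        (∑ R ∈ (Lᶜ).powerset, (if F.lab R = 4 ∧ P ⊆ R ∧ R ⊆ σ.1 then (1 : ZMod 2) else 0))),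
    Finset.sum_filter, F.sum_sup_spectator L (Or.inr hL0)]
  rw [← Finset.sum_filter_add_sum_filter_not (Lᶜ).powerset (fun O => F.lab O = 0 ∧ F.lab (Lᶜ \ O) = 4)]
  rw [show (∑ O ∈ (Lᶜ).powerset.filter (fun O => ¬ (F.lab O = 0 ∧ F.lab (Lᶜ \ O) = 4)),
        (∑ R' ∈ (Lᶜ).powerset, (if F.lab R' = 0 ∧ O ⊆ R' ∧ R' ⊆ Y then (1 : ZMod 2) else 0)) *
        (∑ R ∈ (Lᶜ).powerset, (if F.lab R = 4 ∧ P ⊆ R ∧ R ⊆ Lᶜ \ O then (1 : ZMod 2) else 0))) = 0 from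
      sum_eq_zero fun O hO => by
        have hO' := (mem_filter.1 hO).2
        by_cases h0 : F.lab O = 0
        · have h4 : F.lab (Lᶜ \ O) ≠ 4 := fun h => hO' ⟨h0, h⟩
          rw [show (∑ R ∈ (Lᶜ).powerset, (if F.lab R = 4 ∧ P ⊆ R ∧ R ⊆ Lᶜ \ O then (1 : ZMod 2) else 0)) = 0 from
            sum_eq_zero fun R _ => if_neg fun h' => h4 (F.lab_eq_four_of_subset h'.2.2 h'.1), mul_zero]
        · rw [F.crossM_eq_zero_of_lab_ne Lᶜ h0, zero_mul], add_zero]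
  refine sum_congr rfl fun O hO => ?_
  have hOW : O ⊆ Lᶜ := mem_powerset.1 (mem_filter.1 hO).1
  have h3 : ((Lᶜ \ O) ∪ L)ᶜ = O := third_of_mk hOW
  simp only
  rw [h3]

/-- Pairing of the `N`-functional of `Z ⊆ Kᶜ` (kernel block `K`) with the bare `(3|0)`-vector `μ_Q`: the block sum equals the cube sum
`Σ_{O ⊆ Kᶜ} col_Z(Kᶜ∖O)·μ_Q(O)`. [this work] -/
theorem mu_pair_col_block {K : Finset α} (hK4 : F.lab K = 4) (Q Z : Finset α) :
    (∑ σ : ↥(F.sup.filter (fun σ => σ.2 = K)),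
        (∑ R ∈ (Kᶜ).powerset, (if F.lab R = 4 ∧ Z ⊆ R ∧ R ⊆ σ.1.1 then (1 : ZMod 2) else 0)) *
        (∑ R' ∈ (Kᶜ).powerset, (if F.lab R' = 0 ∧ (σ.1.1 ∪ σ.1.2)ᶜ ⊆ R' ∧ R' ⊆ Q then (1 : ZMod 2) else 0)))
      = ∑ O ∈ (Kᶜ).powerset,
          (∑ R ∈ (Kᶜ).powerset, (if F.lab R = 4 ∧ Z ⊆ R ∧ R ⊆ Kᶜ \ O then (1 : ZMod 2) else 0)) *
          (∑ R' ∈ (Kᶜ).powerset, (if F.lab R' = 0 ∧ O ⊆ R' ∧ R' ⊆ Q then (1 : ZMod 2) else 0)) := by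
  rw [Finset.sum_coe_sort (F.sup.filter (fun σ => σ.2 = K))
    (fun σ => (∑ R ∈ (Kᶜ).powerset, (if F.lab R = 4 ∧ Z ⊆ R ∧ R ⊆ σ.1 then (1 : ZMod 2) else 0)) *
        (∑ R' ∈ (Kᶜ).powerset, (if F.lab R' = 0 ∧ (σ.1 ∪ σ.2)ᶜ ⊆ R' ∧ R' ⊆ Q then (1 : ZMod 2) else 0))),
    Finset.sum_filter, F.sum_sup_spectator K (Or.inl hK4)]
  rw [← Finset.sum_filter_add_sum_filter_not (Kᶜ).powerset (fun O => F.lab O = 0 ∧ F.lab (Kᶜ \ O) = 4)]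
  rw [show (∑ O ∈ (Kᶜ).powerset.filter (fun O => ¬ (F.lab O = 0 ∧ F.lab (Kᶜ \ O) = 4)),
        (∑ R ∈ (Kᶜ).powerset, (if F.lab R = 4 ∧ Z ⊆ R ∧ R ⊆ Kᶜ \ O then (1 : ZMod 2) else 0)) *
        (∑ R' ∈ (Kᶜ).powerset, (if F.lab R' = 0 ∧ O ⊆ R' ∧ R' ⊆ Q then (1 : ZMod 2) else 0))) = 0 from
      sum_eq_zero fun O hO => by
        have hO' := (mem_filter.1 hO).2
        by_cases h0 : F.lab O = 0
        · have h4 : F.lab (Kᶜ \ O) ≠ 4 := fun h => hO' ⟨h0, h⟩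
          rw [show (∑ R ∈ (Kᶜ).powerset, (if F.lab R = 4 ∧ Z ⊆ R ∧ R ⊆ Kᶜ \ O then (1 : ZMod 2) else 0)) = 0 from
            sum_eq_zero fun R _ => if_neg fun h' => h4 (F.lab_eq_four_of_subset h'.2.2 h'.1), zero_mul]
        · rw [show (∑ R' ∈ (Kᶜ).powerset, (if F.lab R' = 0 ∧ O ⊆ R' ∧ R' ⊆ Q then (1 : ZMod 2) else 0)) = 0 from
            sum_eq_zero fun R' _ => if_neg fun h' => h0 (F.lab_eq_zero_of_subset h'.2.1 h'.1), mul_zero], add_zero]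
  refine sum_congr rfl fun O hO => ?_
  have hOW : O ⊆ Kᶜ := mem_powerset.1 (mem_filter.1 hO).1
  have h3 : ((Kᶜ \ O) ∪ K)ᶜ = O := third_of_mk hOW
  simp only
  rw [h3]

/-- **The rival-free `(1|4)`-vectors of a bottom cube are linearly independent** (this work): at a bottom block `L`, the vectors `ν_P` of the
`P ∈ P14(Lᶜ)` having no rival (no label-1 `T ⊆ Lᶜ∖P` with `lab (Lᶜ∖T) = 4`) are independent — the up-reader of the `|P|`-maximal member of a
dependency reads its coefficient (`nu_read_up`). [this work] -/
theorem nu_rivalFree_linearIndependent {L : Finset α} (hL0 : F.lab L = 0) :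
    LinearIndependent (ZMod 2)
      (fun P : ↥((Lᶜ).powerset.filter (fun P => F.lab P = 1 ∧ F.lab (Lᶜ \ P) = 4 ∧
          ∀ T ∈ (Lᶜ \ P).powerset, F.lab T = 1 → F.lab (Lᶜ \ T) ≠ 4)) =>
        fun σ : ↥(F.sup.filter (fun σ => σ.2 = L)) =>
          ∑ R ∈ (Lᶜ).powerset, (if F.lab R = 4 ∧ P.1 ⊆ R ∧ R ⊆ σ.1.1 then (1 : ZMod 2) else 0)) := by
  classical
  set I := (Lᶜ).powerset.filter (fun P => F.lab P = 1 ∧ F.lab (Lᶜ \ P) = 4 ∧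
      ∀ T ∈ (Lᶜ \ P).powerset, F.lab T = 1 → F.lab (Lᶜ \ T) ≠ 4) with hI
  rw [Fintype.linearIndependent_iff]
  intro g hg
  by_contra hne
  push Not at hne
  obtain ⟨i₀, hi₀⟩ := hne
  have hsum : ∀ σ ∈ F.sup, σ.2 = L →
      (∑ i : ↥I, g i * (∑ R ∈ (Lᶜ).powerset, (if F.lab R = 4 ∧ i.1 ⊆ R ∧ R ⊆ σ.1 then (1 : ZMod 2) else 0))) = 0 := by
    intro σ hσ hσS
    have h := congrFun hg ⟨σ, mem_filter.2 ⟨hσ, hσS⟩⟩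
    simp only [Finset.sum_apply, Pi.smul_apply, smul_eq_mul, Pi.zero_apply] at h
    exact h
  obtain ⟨s, hsT, hmax⟩ := Finset.exists_max_image ((Finset.univ : Finset ↥I).filter (fun i => g i ≠ 0))
    (fun i : ↥I => i.1.card) ⟨i₀, mem_filter.2 ⟨mem_univ _, hi₀⟩⟩
  have hgs : g s ≠ 0 := (mem_filter.1 hsT).2
  obtain ⟨hsW, hs1, hs4, hsH⟩ := mem_filter.1 s.2
  have hPS : s.1 ⊆ Lᶜ := mem_powerset.1 hsW
  have H : ∀ T, T ⊆ Lᶜ \ s.1 → F.lab T = 1 → F.lab (Lᶜ \ T) ≠ 4 := fun T hT => hsH T (mem_powerset.2 hT)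
  -- reading of each `ν_i` by `Λ_{s}`
  have hread : ∀ i : ↥I, (∑ Y ∈ (Lᶜ \ s.1).powerset, (if F.lab (Lᶜ \ Y) = 4 then
      ∑ σ : ↥(F.sup.filter (fun σ => σ.2 = L)),
        (∑ R' ∈ (Lᶜ).powerset, (if F.lab R' = 0 ∧ (σ.1.1 ∪ σ.1.2)ᶜ ⊆ R' ∧ R' ⊆ Y then (1 : ZMod 2) else 0)) *
        (∑ R ∈ (Lᶜ).powerset, (if F.lab R = 4 ∧ i.1 ⊆ R ∧ R ⊆ σ.1.1 then (1 : ZMod 2) else 0)) else 0))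
      = if s.1 ⊆ i.1 then 1 else 0 := by
    intro i
    obtain ⟨hiW, hi1, hi4, -⟩ := mem_filter.1 i.2
    rw [← F.nu_read_up Lᶜ hPS (mem_powerset.1 hiW) hs4 hi1 H]
    refine sum_congr rfl fun Y hY => ?_
    by_cases hY4 : F.lab (Lᶜ \ Y) = 4
    · rw [if_pos hY4, if_pos hY4, F.nu_pair_row_block hL0 i.1 Y]
    · rw [if_neg hY4, if_neg hY4]
  -- apply `Λ_s` to the dependency
  have hzero : (∑ i : ↥I, g i * (if s.1 ⊆ i.1 then (1 : ZMod 2) else 0)) = 0 := by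
    rw [show (∑ i : ↥I, g i * (if s.1 ⊆ i.1 then (1 : ZMod 2) else 0))
        = ∑ i : ↥I, ∑ Y ∈ (Lᶜ \ s.1).powerset, g i * (if F.lab (Lᶜ \ Y) = 4 then
            ∑ σ : ↥(F.sup.filter (fun σ => σ.2 = L)),
              (∑ R' ∈ (Lᶜ).powerset, (if F.lab R' = 0 ∧ (σ.1.1 ∪ σ.1.2)ᶜ ⊆ R' ∧ R' ⊆ Y then (1 : ZMod 2) else 0)) *
              (∑ R ∈ (Lᶜ).powerset, (if F.lab R = 4 ∧ i.1 ⊆ R ∧ R ⊆ σ.1.1 then (1 : ZMod 2) else 0)) else 0) from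
      sum_congr rfl fun i _ => by rw [← hread i, Finset.mul_sum]]
    rw [Finset.sum_comm]
    refine sum_eq_zero fun Y _ => ?_
    by_cases hY4 : F.lab (Lᶜ \ Y) = 4
    · simp only [hY4, if_true]
      rw [show (∑ i : ↥I, g i * ∑ σ : ↥(F.sup.filter (fun σ => σ.2 = L)),
              (∑ R' ∈ (Lᶜ).powerset, (if F.lab R' = 0 ∧ (σ.1.1 ∪ σ.1.2)ᶜ ⊆ R' ∧ R' ⊆ Y then (1 : ZMod 2) else 0)) *
              (∑ R ∈ (Lᶜ).powerset, (if F.lab R = 4 ∧ i.1 ⊆ R ∧ R ⊆ σ.1.1 then (1 : ZMod 2) else 0)))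
          = ∑ σ : ↥(F.sup.filter (fun σ => σ.2 = L)),
              (∑ R' ∈ (Lᶜ).powerset, (if F.lab R' = 0 ∧ (σ.1.1 ∪ σ.1.2)ᶜ ⊆ R' ∧ R' ⊆ Y then (1 : ZMod 2) else 0)) *
              (∑ i : ↥I, g i * (∑ R ∈ (Lᶜ).powerset, (if F.lab R = 4 ∧ i.1 ⊆ R ∧ R ⊆ σ.1.1 then (1 : ZMod 2) else 0))) from by
        simp only [Finset.mul_sum]
        rw [Finset.sum_comm]
        exact sum_congr rfl fun σ _ => sum_congr rfl fun i _ => by ring]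
      refine sum_eq_zero fun σ _ => ?_
      rw [hsum σ.1 (mem_filter.1 σ.2).1 (mem_filter.1 σ.2).2, mul_zero]
    · exact sum_eq_zero fun i _ => by rw [if_neg hY4, mul_zero]
  rw [← Finset.sum_erase_add _ _ (mem_univ s)] at hzero
  rw [show (∑ i ∈ (Finset.univ : Finset ↥I).erase s, g i * (if s.1 ⊆ i.1 then (1 : ZMod 2) else 0)) = 0 from
    sum_eq_zero fun i hi => by
      by_cases hgi : g i = 0
      · rw [hgi, zero_mul]
      · have hiT : i ∈ (Finset.univ : Finset ↥I).filter (fun i => g i ≠ 0) := mem_filter.2 ⟨mem_univ _, hgi⟩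
        have hPi : ¬ s.1 ⊆ i.1 := by
          intro hPi
          have heq : i.1 = s.1 := (Finset.eq_of_subset_of_card_le hPi (hmax i hiT)).symm
          exact (mem_erase.1 hi).1 (Subtype.ext heq)
        rw [if_neg hPi, mul_zero], zero_add, if_pos (subset_refl _), mul_one] at hzero
  exact hgs hzero

/-- **The co-rival-free `(3|0)`-vectors of a kernel cube are linearly independent** (this work): at a kernel block `K`, the vectors `μ_Q` of the
`Q ∈ P30(Kᶜ)` having no co-rival (no label-3 `T ⊆ Kᶜ` with `Kᶜ∖Q ⊆ T` and `lab (Kᶜ∖T) = 0`) are independent — the down-reader of the `|Q|`-minimal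
member of a dependency reads its coefficient (`mu_read_down_exact`, junk-free without co-rivals). [this work] -/
theorem mu_corivalFree_linearIndependent {K : Finset α} (hK4 : F.lab K = 4) :
    LinearIndependent (ZMod 2)
      (fun Q : ↥((Kᶜ).powerset.filter (fun Q => F.lab Q = 3 ∧ F.lab (Kᶜ \ Q) = 0 ∧
          ∀ T ∈ (Kᶜ).powerset, Kᶜ \ Q ⊆ T → F.lab T = 3 → F.lab (Kᶜ \ T) ≠ 0)) =>
        fun σ : ↥(F.sup.filter (fun σ => σ.2 = K)) =>
          ∑ R' ∈ (Kᶜ).powerset, (if F.lab R' = 0 ∧ (σ.1.1 ∪ σ.1.2)ᶜ ⊆ R' ∧ R' ⊆ Q.1 then (1 : ZMod 2) else 0)) := by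
  classical
  set I := (Kᶜ).powerset.filter (fun Q => F.lab Q = 3 ∧ F.lab (Kᶜ \ Q) = 0 ∧
      ∀ T ∈ (Kᶜ).powerset, Kᶜ \ Q ⊆ T → F.lab T = 3 → F.lab (Kᶜ \ T) ≠ 0) with hI
  rw [Fintype.linearIndependent_iff]
  intro g hg
  by_contra hne
  push Not at hne
  obtain ⟨i₀, hi₀⟩ := hne
  have hsum : ∀ σ ∈ F.sup, σ.2 = K →
      (∑ i : ↥I, g i * (∑ R' ∈ (Kᶜ).powerset, (if F.lab R' = 0 ∧ (σ.1 ∪ σ.2)ᶜ ⊆ R' ∧ R' ⊆ i.1 then (1 : ZMod 2) else 0))) = 0 := by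
    intro σ hσ hσS
    have h := congrFun hg ⟨σ, mem_filter.2 ⟨hσ, hσS⟩⟩
    simp only [Finset.sum_apply, Pi.smul_apply, smul_eq_mul, Pi.zero_apply] at h
    exact h
  obtain ⟨s, hsT, hmin⟩ := Finset.exists_min_image ((Finset.univ : Finset ↥I).filter (fun i => g i ≠ 0))
    (fun i : ↥I => i.1.card) ⟨i₀, mem_filter.2 ⟨mem_univ _, hi₀⟩⟩
  have hgs : g s ≠ 0 := (mem_filter.1 hsT).2
  obtain ⟨hsW, hs3, hs0, hsH⟩ := mem_filter.1 s.2
  have hQS : s.1 ⊆ Kᶜ := mem_powerset.1 hsW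
  -- the junk of the down-reader of `s` vanishes (no co-rival)
  have hjunk : ∀ Q' : Finset α, (∑ T ∈ (Kᶜ).powerset, (if F.lab T = 3 then
      (∑ R1 ∈ (Kᶜ).powerset, (if F.lab R1 = 0 ∧ R1 ⊆ s.1 ∧ Kᶜ \ T ⊆ R1 then (1 : ZMod 2) else 0)) *
      (∑ R' ∈ (Kᶜ).powerset, (if F.lab R' = 0 ∧ R' ⊆ Q' ∧ R' ⊆ T then (1 : ZMod 2) else 0)) else 0)) = 0 := by
    intro Q'
    refine sum_eq_zero fun T hT => ?_
    by_cases hT3 : F.lab T = 3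
    · rw [if_pos hT3]
      rw [show (∑ R1 ∈ (Kᶜ).powerset, (if F.lab R1 = 0 ∧ R1 ⊆ s.1 ∧ Kᶜ \ T ⊆ R1 then (1 : ZMod 2) else 0)) = 0 from
        sum_eq_zero fun R1 _ => by
          rw [if_neg]
          rintro ⟨hR10, hR1Q, hTR1⟩
          exact hsH T hT (sdiff_subset_comm_of_subset.1 (hTR1.trans hR1Q)) hT3 (F.lab_eq_zero_of_subset hTR1 hR10), zero_mul]
    · rw [if_neg hT3]
  -- reading of each `μ_i` by `Λ*_{s}`
  have hread : ∀ i : ↥I, (∑ Y ∈ (s.1).powerset, (if F.lab Y = 0 then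
      ∑ σ : ↥(F.sup.filter (fun σ => σ.2 = K)),
        (∑ R ∈ (Kᶜ).powerset, (if F.lab R = 4 ∧ Kᶜ \ Y ⊆ R ∧ R ⊆ σ.1.1 then (1 : ZMod 2) else 0)) *
        (∑ R' ∈ (Kᶜ).powerset, (if F.lab R' = 0 ∧ (σ.1.1 ∪ σ.1.2)ᶜ ⊆ R' ∧ R' ⊆ i.1 then (1 : ZMod 2) else 0)) else 0))
      = if i.1 ⊆ s.1 then 1 else 0 := by
    intro i
    obtain ⟨hiW, hi3, -, -⟩ := mem_filter.1 i.2
    have h := F.mu_read_down_exact Kᶜ hQS (mem_powerset.1 hiW) hs0 hi3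
    rw [hjunk i.1, add_zero] at h
    rw [← h]
    refine sum_congr rfl fun Y hY => ?_
    by_cases hY0 : F.lab Y = 0
    · rw [if_pos hY0, if_pos hY0, F.mu_pair_col_block hK4 i.1 (Kᶜ \ Y)]
    · rw [if_neg hY0, if_neg hY0]
  have hzero : (∑ i : ↥I, g i * (if i.1 ⊆ s.1 then (1 : ZMod 2) else 0)) = 0 := by
    rw [show (∑ i : ↥I, g i * (if i.1 ⊆ s.1 then (1 : ZMod 2) else 0))
        = ∑ i : ↥I, ∑ Y ∈ (s.1).powerset, g i * (if F.lab Y = 0 then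
            ∑ σ : ↥(F.sup.filter (fun σ => σ.2 = K)),
              (∑ R ∈ (Kᶜ).powerset, (if F.lab R = 4 ∧ Kᶜ \ Y ⊆ R ∧ R ⊆ σ.1.1 then (1 : ZMod 2) else 0)) *
              (∑ R' ∈ (Kᶜ).powerset, (if F.lab R' = 0 ∧ (σ.1.1 ∪ σ.1.2)ᶜ ⊆ R' ∧ R' ⊆ i.1 then (1 : ZMod 2) else 0)) else 0) from
      sum_congr rfl fun i _ => by rw [← hread i, Finset.mul_sum]]
    rw [Finset.sum_comm]
    refine sum_eq_zero fun Y _ => ?_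
    by_cases hY0 : F.lab Y = 0
    · simp only [hY0, if_true]
      rw [show (∑ i : ↥I, g i * ∑ σ : ↥(F.sup.filter (fun σ => σ.2 = K)),
              (∑ R ∈ (Kᶜ).powerset, (if F.lab R = 4 ∧ Kᶜ \ Y ⊆ R ∧ R ⊆ σ.1.1 then (1 : ZMod 2) else 0)) *
              (∑ R' ∈ (Kᶜ).powerset, (if F.lab R' = 0 ∧ (σ.1.1 ∪ σ.1.2)ᶜ ⊆ R' ∧ R' ⊆ i.1 then (1 : ZMod 2) else 0)))
          = ∑ σ : ↥(F.sup.filter (fun σ => σ.2 = K)),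
              (∑ R ∈ (Kᶜ).powerset, (if F.lab R = 4 ∧ Kᶜ \ Y ⊆ R ∧ R ⊆ σ.1.1 then (1 : ZMod 2) else 0)) *
              (∑ i : ↥I, g i * (∑ R' ∈ (Kᶜ).powerset, (if F.lab R' = 0 ∧ (σ.1.1 ∪ σ.1.2)ᶜ ⊆ R' ∧ R' ⊆ i.1 then (1 : ZMod 2) else 0))) from by
        simp only [Finset.mul_sum]
        rw [Finset.sum_comm]
        exact sum_congr rfl fun σ _ => sum_congr rfl fun i _ => by ring]
      refine sum_eq_zero fun σ _ => ?_
      rw [hsum σ.1 (mem_filter.1 σ.2).1 (mem_filter.1 σ.2).2, mul_zero]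
    · exact sum_eq_zero fun i _ => by rw [if_neg hY0, mul_zero]
  rw [← Finset.sum_erase_add _ _ (mem_univ s)] at hzero
  rw [show (∑ i ∈ (Finset.univ : Finset ↥I).erase s, g i * (if i.1 ⊆ s.1 then (1 : ZMod 2) else 0)) = 0 from
    sum_eq_zero fun i hi => by
      by_cases hgi : g i = 0
      · rw [hgi, zero_mul]
      · have hiT : i ∈ (Finset.univ : Finset ↥I).filter (fun i => g i ≠ 0) := mem_filter.2 ⟨mem_univ _, hgi⟩
        have hPi : ¬ i.1 ⊆ s.1 := by
          intro hPi
          have heq : i.1 = s.1 := Finset.eq_of_subset_of_card_le hPi (hmin i hiT)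
          exact (mem_erase.1 hi).1 (Subtype.ext heq)
        rw [if_neg hPi, mul_zero], zero_add, if_pos (subset_refl _), mul_one] at hzero
  exact hgs hzero

/-- **★ FROM THE RIVAL-FREE COUNT** (this work; unconditional, purely combinatorial hypothesis).  If the number of rainbows is at most the number of
pairs `(L, P)` — `L` bottom, `P ∈ P14(Lᶜ)` rival-free in `Lᶜ` — plus the number of pairs `(K, Q)` — `K` kernel, `Q ∈ P30(Kᶜ)` co-rival-free in `Kᶜ` —,
then `0 ≤ ZH`: these families are independent inside their cubes (`nu_rivalFree_linearIndependent`, `mu_corivalFree_linearIndependent`), hence each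
count is at most the cube's slack (`finrank_span_le_cubeSlack`).  CENSUS (gen 24): the hypothesis holds for all 780 sunflowers with rainbows on 4 points,
for ~10⁴ random / 'hard' sunflowers on 5–8 points, the doubled star (tight) and `CS(3,3,3)`, but NOT always (3 of 6 766 sampled compositions on ≤ 7 points;
there the ν-rank is larger than the rival-free count, and `NuMuSpanInequality` still holds). [this work] -/
theorem ZH_nonneg_of_rivalFreeCount
    (h : (F.rainbowCard : ℤ) ≤
      (∑ L ∈ (Finset.univ : Finset (Finset α)).filter (fun L => F.lab L = 0),
        (((Lᶜ).powerset.filter (fun P => F.lab P = 1 ∧ F.lab (Lᶜ \ P) = 4 ∧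
            ∀ T ∈ (Lᶜ \ P).powerset, F.lab T = 1 → F.lab (Lᶜ \ T) ≠ 4)).card : ℤ))
      + ∑ K ∈ (Finset.univ : Finset (Finset α)).filter (fun K => F.lab K = 4),
        (((Kᶜ).powerset.filter (fun Q => F.lab Q = 3 ∧ F.lab (Kᶜ \ Q) = 0 ∧
            ∀ T ∈ (Kᶜ).powerset, Kᶜ \ Q ⊆ T → F.lab T = 3 → F.lab (Kᶜ \ T) ≠ 0)).card : ℤ)) :
    0 ≤ F.ZH := by
  classical
  have hB : ∀ L ∈ (Finset.univ : Finset (Finset α)).filter (fun L => F.lab L = 0),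
      (((Lᶜ).powerset.filter (fun P => F.lab P = 1 ∧ F.lab (Lᶜ \ P) = 4 ∧
            ∀ T ∈ (Lᶜ \ P).powerset, F.lab T = 1 → F.lab (Lᶜ \ T) ≠ 4)).card : ℤ) ≤ F.cubeSlack Lᶜ := by
    intro L hL
    have hL0 : F.lab L = 0 := (mem_filter.1 hL).2
    have hli := F.nu_rivalFree_linearIndependent hL0
    have hdim := finrank_span_eq_card hli
    rw [Fintype.card_coe] at hdim
    have horth : ∀ (P : ↥((Lᶜ).powerset.filter (fun P => F.lab P = 1 ∧ F.lab (Lᶜ \ P) = 4 ∧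
            ∀ T ∈ (Lᶜ \ P).powerset, F.lab T = 1 → F.lab (Lᶜ \ T) ≠ 4))),
        ∀ d ∈ (F.dem.filter (fun d => ¬ F.IsRainbow d)).filter (fun d => d.1 = L),
          (∑ σ : ↥(F.sup.filter (fun σ => σ.2 = L)), F.specRow d σ.1 *
            (∑ R ∈ (Lᶜ).powerset, (if F.lab R = 4 ∧ P.1 ⊆ R ∧ R ⊆ σ.1.1 then (1 : ZMod 2) else 0))) = 0 := by
      intro P d hd
      have hdL : d.1 = L := (mem_filter.1 hd).2
      subst hdL
      obtain ⟨hPW, hP1, hcP, -⟩ := mem_filter.1 P.2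
      exact F.nu_orth_block (mem_filter.1 hd).1 hL0 (mem_powerset.1 hPW) hP1 hcP
    have hle := F.finrank_span_le_cubeSlack L (Or.inr hL0) _ horth
    rw [hdim] at hle
    exact hle
  have hA : ∀ K ∈ (Finset.univ : Finset (Finset α)).filter (fun K => F.lab K = 4),
      (((Kᶜ).powerset.filter (fun Q => F.lab Q = 3 ∧ F.lab (Kᶜ \ Q) = 0 ∧
            ∀ T ∈ (Kᶜ).powerset, Kᶜ \ Q ⊆ T → F.lab T = 3 → F.lab (Kᶜ \ T) ≠ 0)).card : ℤ) ≤ F.cubeSlack Kᶜ := by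
    intro K hK
    have hK4 : F.lab K = 4 := (mem_filter.1 hK).2
    have hli := F.mu_corivalFree_linearIndependent hK4
    have hdim := finrank_span_eq_card hli
    rw [Fintype.card_coe] at hdim
    have horth : ∀ (Q : ↥((Kᶜ).powerset.filter (fun Q => F.lab Q = 3 ∧ F.lab (Kᶜ \ Q) = 0 ∧
            ∀ T ∈ (Kᶜ).powerset, Kᶜ \ Q ⊆ T → F.lab T = 3 → F.lab (Kᶜ \ T) ≠ 0))),
        ∀ d ∈ (F.dem.filter (fun d => ¬ F.IsRainbow d)).filter (fun d => d.1 = K),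
          (∑ σ : ↥(F.sup.filter (fun σ => σ.2 = K)), F.specRow d σ.1 *
            (∑ R' ∈ (Kᶜ).powerset, (if F.lab R' = 0 ∧ (σ.1.1 ∪ σ.1.2)ᶜ ⊆ R' ∧ R' ⊆ Q.1 then (1 : ZMod 2) else 0))) = 0 := by
      intro Q d hd
      have hdK : d.1 = K := (mem_filter.1 hd).2
      subst hdK
      obtain ⟨hQW, hQ3, hcQ, -⟩ := mem_filter.1 Q.2
      exact F.mu_orth_block (mem_filter.1 hd).1 hK4 (mem_powerset.1 hQW) hQ3 hcQ
    have hle := F.finrank_span_le_cubeSlack K (Or.inl hK4) _ horth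
    rw [hdim] at hle
    exact hle
  have h1 := Finset.sum_le_sum hB
  have h2 := Finset.sum_le_sum hA
  rw [F.ZH_eq_six_slack]
  linarith

end Sunflower

end Summit.CriticalPhenomena.PercolationContinuityZ3.Theorems.SunflowerPartition
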